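import Summits.Ventures.PercRepro.C041SkeletonCountDefs

/-!
# THEOREM R, the reduction, THE COUNT: `Σ_{S ∈ 𝒮(O)} (3g(S) − 2) = N · Φ∨ (portOf O) ≥ 0` (p6, gen 23)

Setting of `C041SkeletonCountDefs` (mine-3, C-041.md §3 / §6 (d), plan §7).  Fix a colouring `O` of the bare edges and
let `𝒮(O)` be the `(D,A)` sources of the singleton-attachment family agreeing with `O` on the bare edges.  Their
port problem is `P := portOf O` (`portOf_congr`) and their weights are the weights of their patterns
(`weight_patternOf`).  The fibres of `S ↦ pat S` over the admissible valid patterns all have the same size: the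
RECOLOURING `recolour O x′ S` (the terminal edges at the ports recoloured by `x′`, everything else kept) maps the fibre
of `x` bijectively onto the fibre of `x′` (the converse dictionary `DA_of_adm` shows the image is a source); the other
fibres are empty.  Hence `Σ_{𝒮(O)} (3g − 2) = N · Φ∨ P` and, by THE LEMMA `phiOr_nonneg` (the ports of `P` are reached
from `c` in `K`), `0 ≤ Σ_{𝒮(O)} (3g − 2)`: **mine-3's «(CC) on `𝒮_sing(O)`» as a tree theorem**
(`sum_goodDegree_nonneg_of_bare`), for skeletons with a terminal edge, `c` not adjacent to a terminal and at most one
edge from a vertex to each terminal.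
-/

namespace PercRepro

namespace MultiGraph

open Finset PortProblem

variable {V E : Type*} {G : MultiGraph V E}

section Recolour

variable [Fintype V] {a b c : V} (hc : ∀ e, ¬ G.Joins e c a ∧ ¬ G.Joins e c b) (hca : c ≠ a) (hcb : c ≠ b)
  (O : Config E)

omit [Fintype V] in
include hca hcb in
/-- The red bare cluster of `c` contains no terminal. -/
theorem bareReach_ne_terminal {u : V} (hu : u ∈ G.BareReach a b c O) : u ≠ a ∧ u ≠ b := by
  induction hu with
  | refl => exact ⟨hca, hcb⟩
  | tail _ hxy _ =>
    obtain ⟨e, he, _, hj⟩ := hxy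
    exact (ne_of_bare_joins he hj).2

include hca hcb in
/-- A port is not a terminal. -/
theorem port_ne_terminal {u : V} (hu : u ∈ (G.portOf a b c hc O).M) : u ≠ a ∧ u ≠ b :=
  bareReach_ne_terminal hca hcb O ((mem_portM hc).1 hu).1

/-- The terminal of a term. -/
def termEnd (t : (G.portOf a b c hc O).Term) : V := cond t.1.2 b a

include hca hcb in
/-- **Uniqueness of the term of an edge**: two terms whose edges coincide are equal (`UniqTerm` is not even needed:
the term is read off the endpoints). -/
theorem term_unique (hne : a ≠ b) {e : E} {t t' : (G.portOf a b c hc O).Term}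
    (ht : G.Joins e t.1.1 (termEnd hc O t)) (ht' : G.Joins e t'.1.1 (termEnd hc O t')) : t = t' := by
  have hp := port_ne_terminal hc hca hcb O t.2.1
  have hp' := port_ne_terminal hc hca hcb O t'.2.1
  apply Subtype.ext
  -- the endpoints of `e` are `{t.1.1, termEnd t}` and `{t'.1.1, termEnd t'}`; a port is not a terminal
  have hends : (t.1.1 = t'.1.1 ∧ termEnd hc O t = termEnd hc O t') ∨
      (t.1.1 = termEnd hc O t' ∧ termEnd hc O t = t'.1.1) := by
    rcases ht with ⟨h1, h2⟩ | ⟨h1, h2⟩ <;> rcases ht' with ⟨h3, h4⟩ | ⟨h3, h4⟩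
    · exact Or.inl ⟨h1.symm.trans h3, h2.symm.trans h4⟩
    · exact Or.inr ⟨h1.symm.trans h3, h2.symm.trans h4⟩
    · exact Or.inr ⟨h2.symm.trans h4, h1.symm.trans h3⟩
    · exact Or.inl ⟨h2.symm.trans h4, h1.symm.trans h3⟩
  rcases hends with ⟨h1, h2⟩ | ⟨h1, _⟩
  · refine Prod.ext h1 ?_
    unfold termEnd at h2
    cases hb1 : t.1.2 <;> cases hb2 : t'.1.2 <;> simp only [hb1, hb2, cond_true, cond_false] at h2 ⊢
    · exact absurd h2 hne
    · exact absurd h2.symm hne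
  · exfalso
    unfold termEnd at h1
    cases hb2 : t'.1.2 <;> simp only [hb2, cond_true, cond_false] at h1
    · exact hp.1 h1
    · exact hp.2 h1

open Classical in
/-- **The recolouring**: the terminal edges at the ports take the colours `x′`, every other edge keeps its colour. -/
noncomputable def recolour (x' : (G.portOf a b c hc O).Term → Bool) (S : Config E) : Config E :=
  fun e => if h : ∃ t : (G.portOf a b c hc O).Term, G.Joins e t.1.1 (termEnd hc O t) then x' (Classical.choose h)
    else S e

/-- A bare edge is the edge of no term. -/
theorem not_term_of_bare {e : E} (he : G.Bare a b e) (t : (G.portOf a b c hc O).Term) :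
    ¬ G.Joins e t.1.1 (termEnd hc O t) := by
  intro hj
  have := (ne_of_bare_joins he hj).2
  unfold termEnd at this
  cases h : t.1.2 <;> simp only [h, cond_true, cond_false] at this
  · exact this.1 rfl
  · exact this.2 rfl

/-- The recolouring keeps the bare edges. -/
theorem recolour_bare (x' : (G.portOf a b c hc O).Term → Bool) (S : Config E) {e : E} (he : G.Bare a b e) :
    G.recolour hc O x' S e = S e := by
  unfold recolour
  rw [dif_neg]
  rintro ⟨t, ht⟩
  exact not_term_of_bare hc O he t ht

include hca hcb in
/-- The recolouring colours the edge of a term by `x′`. -/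
theorem recolour_term (hne : a ≠ b) (x' : (G.portOf a b c hc O).Term → Bool) (S : Config E)
    {e : E} {t : (G.portOf a b c hc O).Term} (ht : G.Joins e t.1.1 (termEnd hc O t)) :
    G.recolour hc O x' S e = x' t := by
  unfold recolour
  rw [dif_pos ⟨t, ht⟩]
  congr 1
  exact term_unique hc hca hcb O hne (Classical.choose_spec (⟨t, ht⟩ : ∃ t', G.Joins e t'.1.1 (termEnd hc O t'))) ht

/-- The recolouring keeps the edges at no port. -/
theorem recolour_of_not_term (x' : (G.portOf a b c hc O).Term → Bool) (S : Config E) {e : E}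
    (he : ¬ ∃ t : (G.portOf a b c hc O).Term, G.Joins e t.1.1 (termEnd hc O t)) :
    G.recolour hc O x' S e = S e := by
  unfold recolour
  rw [dif_neg he]

open Classical in
/-- An edge at a terminal whose other end is a port is the edge of a term. -/
theorem exists_term_of_joins {e : E} {u : V} (hu : u ∈ (G.portOf a b c hc O).M)
    (hj : G.Joins e u a ∨ G.Joins e u b) :
    ∃ t : (G.portOf a b c hc O).Term, G.Joins e t.1.1 (termEnd hc O t) := by
  rcases hj with hj | hj
  · exact ⟨⟨(u, false), hu, fun _ => decide_eq_true_iff.2 ⟨e, hj⟩, fun h => Bool.noConfusion h⟩, hj⟩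
  · exact ⟨⟨(u, true), hu, fun h => Bool.noConfusion h, fun _ => decide_eq_true_iff.2 ⟨e, hj⟩⟩, hj⟩

include hca hcb in
/-- An edge of a term joins a port to a terminal; if its port is `u` then `u` is a port. -/
theorem port_of_term {e : E} {u : V} {t : (G.portOf a b c hc O).Term}
    (ht : G.Joins e t.1.1 (termEnd hc O t)) (hj : G.Joins e u a ∨ G.Joins e u b) (hu : u ≠ a ∧ u ≠ b) :
    t.1.1 = u := by
  have hp := port_ne_terminal hc hca hcb O t.2.1
  rcases hj with hj | hj <;> rcases hj with ⟨h1, h2⟩ | ⟨h1, h2⟩ <;> rcases ht with ⟨h3, h4⟩ | ⟨h3, h4⟩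
  · exact h3.symm.trans h1
  · exfalso
    unfold termEnd at h3
    cases h : t.1.2 <;> simp only [h, cond_true, cond_false] at h3
    · exact hu.1 (h1.symm.trans h3)
    · exact hu.2 (h1.symm.trans h3)
  · exfalso
    unfold termEnd at h4
    cases h : t.1.2 <;> simp only [h, cond_true, cond_false] at h4
    · exact hu.1 (h2.symm.trans h4)
    · exact hu.2 (h2.symm.trans h4)
  · exact h4.symm.trans h2
  · exact h3.symm.trans h1
  · exfalso
    unfold termEnd at h3
    cases h : t.1.2 <;> simp only [h, cond_true, cond_false] at h3
    · exact hu.1 (h1.symm.trans h3)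
    · exact hu.2 (h1.symm.trans h3)
  · exfalso
    unfold termEnd at h4
    cases h : t.1.2 <;> simp only [h, cond_true, cond_false] at h4
    · exact hu.1 (h2.symm.trans h4)
    · exact hu.2 (h2.symm.trans h4)
  · exact h4.symm.trans h2

include hca hcb in
open Classical in
/-- **The pattern of a recoloured configuration is `x′`** (at the ports; `UniqTerm` is needed for the 1-edge /
2-edge to be THE edge). -/
theorem pat_recolour (hne : a ≠ b) (huniq : G.UniqTerm a b) (x' : (G.portOf a b c hc O).Term → Bool)
    (S : Config E) (t : (G.portOf a b c hc O).Term) : G.pat a b (G.recolour hc O x' S) t.1 = x' t := by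
  unfold pat
  cases h2 : t.1.2
  · -- the 1-edge
    obtain ⟨e, he⟩ := decide_eq_true_iff.1 (t.2.2.1 h2)
    have hte : G.Joins e t.1.1 (termEnd hc O t) := by
      unfold termEnd
      rw [h2]
      exact he
    simp only [cond_false]
    cases hx : x' t
    · apply decide_eq_false_iff_not.2
      rintro ⟨e', he', hS'⟩
      rw [huniq.1 _ _ _ he' he, recolour_term hc hca hcb O hne x' S hte, hx] at hS'
      exact Bool.noConfusion hS'
    · apply decide_eq_true_iff.2
      exact ⟨e, he, by rw [recolour_term hc hca hcb O hne x' S hte, hx]⟩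
  · obtain ⟨e, he⟩ := decide_eq_true_iff.1 (t.2.2.2 h2)
    have hte : G.Joins e t.1.1 (termEnd hc O t) := by
      unfold termEnd
      rw [h2]
      exact he
    simp only [cond_true]
    cases hx : x' t
    · apply decide_eq_false_iff_not.2
      rintro ⟨e', he', hS'⟩
      rw [huniq.2 _ _ _ he' he, recolour_term hc hca hcb O hne x' S hte, hx] at hS'
      exact Bool.noConfusion hS'
    · apply decide_eq_true_iff.2
      exact ⟨e, he, by rw [recolour_term hc hca hcb O hne x' S hte, hx]⟩

include hca hcb in
open Classical in
/-- **Recolouring by the own pattern is the identity.** -/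
theorem recolour_self (hne : a ≠ b) (huniq : G.UniqTerm a b) (S : Config E) :
    G.recolour hc O (fun t => G.pat a b S t.1) S = S := by
  funext e
  by_cases h : ∃ t : (G.portOf a b c hc O).Term, G.Joins e t.1.1 (termEnd hc O t)
  · obtain ⟨t, ht⟩ := h
    rw [recolour_term hc hca hcb O hne _ S ht]
    unfold pat
    cases h2 : t.1.2
    · have hte : G.Joins e t.1.1 a := by
        unfold termEnd at ht
        rw [h2] at ht
        exact ht
      simp only [cond_false]
      cases hS : S e
      · apply decide_eq_false_iff_not.2
        rintro ⟨e', he', hS'⟩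
        rw [huniq.1 _ _ _ he' hte, hS] at hS'
        exact Bool.noConfusion hS'
      · exact decide_eq_true_iff.2 ⟨e, hte, hS⟩
    · have hte : G.Joins e t.1.1 b := by
        unfold termEnd at ht
        rw [h2] at ht
        exact ht
      simp only [cond_true]
      cases hS : S e
      · apply decide_eq_false_iff_not.2
        rintro ⟨e', he', hS'⟩
        rw [huniq.2 _ _ _ he' hte, hS] at hS'
        exact Bool.noConfusion hS'
      · exact decide_eq_true_iff.2 ⟨e, hte, hS⟩
  · exact recolour_of_not_term hc O _ S h

include hca hcb in
/-- Recolouring twice is recolouring once. -/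
theorem recolour_recolour (hne : a ≠ b) (x x' : (G.portOf a b c hc O).Term → Bool) (S : Config E) :
    G.recolour hc O x (G.recolour hc O x' S) = G.recolour hc O x S := by
  funext e
  by_cases h : ∃ t : (G.portOf a b c hc O).Term, G.Joins e t.1.1 (termEnd hc O t)
  · obtain ⟨t, ht⟩ := h
    rw [recolour_term hc hca hcb O hne x _ ht, recolour_term hc hca hcb O hne x S ht]
  · rw [recolour_of_not_term hc O x _ h, recolour_of_not_term hc O x' S h, recolour_of_not_term hc O x S h]

end Recolour

end MultiGraph

end PercRepro
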